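import Summits.BirchSwinnertonDyer.BirchSwinnertonDyer.Theorems.ManinLocalTwoThreeQFareyTransport

/-!
# q-ADIC CUSPS are connected to `0`; the ORBIT-GRAPH PREDICATE over `ℚ` (cell bsd-f2-manin, analytic lens g30, MEMO-an §72.3 / §72.7
# rung L4: second arithmetic file of the instantiation E-an-141 ⟹ E-an-140 `QFareyFibreConnected`)

Summit `BirchSwinnertonDyer`, route `ManinLocalTwoThree`, cruxes C3 `ManinPrimeToThreeAtNine` (stmt-BirchSwinnertonDyer-22968) / C2 `ManinOddAtFour`
(stmt-…-22967).  Continues `…QFareyTransport` (LEMMA T):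

* `qFarey_reflTransGen_zero_qadic` (LEMMA Q) — every q-adic cusp `m/qʲ` is joined to `0` by q-Farey edges inside the fibre
  (`m/qʲ ∼ (m∓1)/qʲ ∼ … ∼ 0`; these are the images of `0` under the upper Borel `B⁺(ℤ[1/q])`);
* the orbit-graph predicate `𝒫(a,b,c,d)` := "on every fibre vertex `x`: `c x + d ≠ 0`, the image `(a x + b)/(c x + d)` is a fibre vertex,
  and connectivity to `0` is transported" — written out in full in each statement (no definitions in a proof file): it holds at the
  identity (`moebiusGood_one`), is closed under the Möbius product (`moebiusGood_mul`), and holds for rational entries with an integral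
  form of S-congruence shape as soon as `b/d` is joined to `0` (`moebiusGood_of_integral`, LEMMA T assembled edge by edge).

HONEST FRAMING: elementary; nothing about Manin's conjecture or BSD is proved here.
-/

set_option linter.dupNamespace false
set_option autoImplicit false

namespace Summit.BirchSwinnertonDyer.BirchSwinnertonDyer.Theorems.ManinLocalTwoThree

open Summit.BirchSwinnertonDyer.Rank1Residual.ManinAdditive.TowerExtension

/-! ## LEMMA Q — the q-adic cusps `m / qʲ` are joined to `0` inside the fibre -/

section QAdic

variable {N q : ℕ}

/-- The denominator of `m/qʲ` is a power of `q`. -/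
theorem exists_den_qadic_eq_pow (hq : q.Prime) (m : ℤ) (j : ℕ) :
    ∃ i : ℕ, ((m : ℚ) / (q : ℚ) ^ j).den = q ^ i := by
  have h := Rat.den_dvd m ((q : ℤ) ^ j)
  rw [Rat.divInt_eq_div] at h
  push_cast at h
  have h' : (((m : ℚ) / (q : ℚ) ^ j).den : ℤ) ∣ (q : ℤ) ^ j := h
  obtain ⟨i, -, hi⟩ := natAbs_eq_pow_of_dvd_prime_pow hq h'
  exact ⟨i, by simpa using hi⟩

/-- `num · qʲ = m · den` for `m/qʲ`. -/
theorem num_mul_pow_eq_of_qadic (hq : q.Prime) (m : ℤ) (j : ℕ) :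
    ((m : ℚ) / (q : ℚ) ^ j).num * (q : ℤ) ^ j = m * ((m : ℚ) / (q : ℚ) ^ j).den := by
  set x := (m : ℚ) / (q : ℚ) ^ j with hx
  have hqj : ((q : ℚ) ^ j) ≠ 0 := pow_ne_zero _ (by exact_mod_cast hq.ne_zero)
  have hden : (x.den : ℚ) ≠ 0 := by exact_mod_cast x.den_pos.ne'
  have h1 : (x.num : ℚ) / x.den = (m : ℚ) / (q : ℚ) ^ j := by rw [Rat.num_div_den]
  rw [div_eq_div_iff hden hqj] at h1
  exact_mod_cast h1

/-- Powers of `q` lie in the fibre. -/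
theorem inFibre_pow (hqN : q.Coprime N) (i : ℕ) : InFibre N q (q ^ i) :=
  ⟨Nat.Coprime.pow_left i hqN, i, Or.inl (by push_cast; rfl)⟩

/-- Consecutive q-adic cusps `m/qʲ`, `(m+s)/qʲ` (`s = ±1`) are q-Farey adjacent. -/
theorem qFareyAdj_qadic_step (hq : q.Prime) (hqN : q.Coprime N) (m : ℤ) (j : ℕ) {s : ℤ} (hs : s = 1 ∨ s = -1) :
    QFareyAdj N q (((m : ℚ) / (q : ℚ) ^ j).num, ((m : ℚ) / (q : ℚ) ^ j).den)
      ((((m + s : ℤ) : ℚ) / (q : ℚ) ^ j).num, (((m + s : ℤ) : ℚ) / (q : ℚ) ^ j).den) := by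
  set x := (m : ℚ) / (q : ℚ) ^ j with hx
  set y := ((m + s : ℤ) : ℚ) / (q : ℚ) ^ j with hy
  obtain ⟨i, hi⟩ := exists_den_qadic_eq_pow hq m j
  obtain ⟨i', hi'⟩ := exists_den_qadic_eq_pow hq (m + s) j
  have hxn := num_mul_pow_eq_of_qadic hq m j
  have hyn := num_mul_pow_eq_of_qadic hq (m + s) j
  rw [← hx] at hi hxn
  rw [← hy] at hi' hyn
  refine ⟨x.den_pos, y.den_pos, Rat.int_gcd_num_den x, Rat.int_gcd_num_den y, hi ▸ inFibre_pow hqN i,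
    hi' ▸ inFibre_pow hqN i', ?_⟩
  simp only
  -- `qʲ (num_x den_y − num_y den_x) = −s den_x den_y`
  have hcross : (x.num * y.den - y.num * x.den) * (q : ℤ) ^ j = -s * (x.den * y.den) := by
    have : (x.num * y.den - y.num * x.den) * (q : ℤ) ^ j = (x.num * (q : ℤ) ^ j) * y.den - (y.num * (q : ℤ) ^ j) * x.den := by
      ring
    rw [this, hxn, hyn]; ring
  have habs : (x.num * y.den - y.num * x.den).natAbs * q ^ j = x.den * y.den := by
    have h1 := congrArg Int.natAbs hcross
    rw [Int.natAbs_mul, Int.natAbs_mul, Int.natAbs_neg, Int.natAbs_mul, Int.natAbs_pow, Int.natAbs_natCast] at h1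
    have hs1 : s.natAbs = 1 := by rcases hs with rfl | rfl <;> rfl
    rw [hs1, one_mul, Int.natAbs_natCast, Int.natAbs_natCast] at h1
    exact h1
  have hdvd : (x.num * y.den - y.num * x.den).natAbs ∣ q ^ (i + i') :=
    ⟨q ^ j, by rw [pow_add, ← hi, ← hi', habs]⟩
  obtain ⟨n, -, hn⟩ := (Nat.dvd_prime_pow hq).mp hdvd
  refine ⟨n, ?_⟩
  rw [Int.abs_eq_natAbs, hn]
  push_cast
  rfl

/-- **LEMMA Q**: every q-adic cusp `m/qʲ` is joined to `0` by q-Farey edges inside the fibre (`m/qʲ ∼ (m∓1)/qʲ ∼ … ∼ 0`). -/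
theorem qFarey_reflTransGen_zero_qadic (hq : q.Prime) (hqN : q.Coprime N) (j : ℕ) (m : ℤ) :
    Relation.ReflTransGen (fun x y : ℚ ↦ QFareyAdj N q (x.num, x.den) (y.num, y.den)) 0 ((m : ℚ) / (q : ℚ) ^ j) := by
  induction m using Int.induction_on with
  | zero => simp only [Int.cast_zero, zero_div]; exact Relation.ReflTransGen.refl
  | succ n ih =>
    refine ih.tail ?_
    have h := qFareyAdj_qadic_step (N := N) hq hqN n j (s := 1) (Or.inl rfl)
    simpa only [Int.cast_add, Int.cast_one] using h
  | pred n ih =>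
    refine ih.tail ?_
    have h := qFareyAdj_qadic_step (N := N) hq hqN (-(n : ℤ)) j (s := -1) (Or.inr rfl)
    simpa only [Int.cast_add, Int.cast_neg, Int.cast_natCast, Int.cast_one, ← sub_eq_add_neg] using h

end QAdic

/-! ## The orbit-graph predicate `𝒫` over `ℚ`: identity, products, integral S-congruence data -/

section Good

variable {N q : ℕ}

/-- `𝒫(1, 0, 0, 1)`. -/
theorem moebiusGood_one :
    ∀ x : ℚ, InFibre N q x.den →
      (0 : ℚ) * x + 1 ≠ 0 ∧ InFibre N q (((1 : ℚ) * x + 0) / ((0 : ℚ) * x + 1)).den ∧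
        (Relation.ReflTransGen (fun x y : ℚ ↦ QFareyAdj N q (x.num, x.den) (y.num, y.den)) 0 x →
          Relation.ReflTransGen (fun x y : ℚ ↦ QFareyAdj N q (x.num, x.den) (y.num, y.den)) 0
            (((1 : ℚ) * x + 0) / ((0 : ℚ) * x + 1))) := by
  intro x hx
  simp only [zero_mul, zero_add, one_mul, add_zero, div_one, ne_eq, one_ne_zero, not_false_eq_true, true_and]
  exact ⟨hx, id⟩

/-- `𝒫` is closed under the Möbius product (composition of fractional linear maps). -/
theorem moebiusGood_mul {a₁ b₁ c₁ d₁ a₂ b₂ c₂ d₂ : ℚ}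
    (h₁ : ∀ x : ℚ, InFibre N q x.den →
      c₁ * x + d₁ ≠ 0 ∧ InFibre N q ((a₁ * x + b₁) / (c₁ * x + d₁)).den ∧
        (Relation.ReflTransGen (fun x y : ℚ ↦ QFareyAdj N q (x.num, x.den) (y.num, y.den)) 0 x →
          Relation.ReflTransGen (fun x y : ℚ ↦ QFareyAdj N q (x.num, x.den) (y.num, y.den)) 0
            ((a₁ * x + b₁) / (c₁ * x + d₁))))
    (h₂ : ∀ x : ℚ, InFibre N q x.den →
      c₂ * x + d₂ ≠ 0 ∧ InFibre N q ((a₂ * x + b₂) / (c₂ * x + d₂)).den ∧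
        (Relation.ReflTransGen (fun x y : ℚ ↦ QFareyAdj N q (x.num, x.den) (y.num, y.den)) 0 x →
          Relation.ReflTransGen (fun x y : ℚ ↦ QFareyAdj N q (x.num, x.den) (y.num, y.den)) 0
            ((a₂ * x + b₂) / (c₂ * x + d₂)))) :
    ∀ x : ℚ, InFibre N q x.den →
      (c₁ * a₂ + d₁ * c₂) * x + (c₁ * b₂ + d₁ * d₂) ≠ 0 ∧
        InFibre N q (((a₁ * a₂ + b₁ * c₂) * x + (a₁ * b₂ + b₁ * d₂)) / ((c₁ * a₂ + d₁ * c₂) * x + (c₁ * b₂ + d₁ * d₂))).den ∧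
        (Relation.ReflTransGen (fun x y : ℚ ↦ QFareyAdj N q (x.num, x.den) (y.num, y.den)) 0 x →
          Relation.ReflTransGen (fun x y : ℚ ↦ QFareyAdj N q (x.num, x.den) (y.num, y.den)) 0
            (((a₁ * a₂ + b₁ * c₂) * x + (a₁ * b₂ + b₁ * d₂)) / ((c₁ * a₂ + d₁ * c₂) * x + (c₁ * b₂ + d₁ * d₂)))) := by
  intro x hx
  obtain ⟨hne₂, hfib₂, hconn₂⟩ := h₂ x hx
  set y := (a₂ * x + b₂) / (c₂ * x + d₂) with hy
  obtain ⟨hne₁, hfib₁, hconn₁⟩ := h₁ y hfib₂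
  have hden : (c₁ * a₂ + d₁ * c₂) * x + (c₁ * b₂ + d₁ * d₂) = (c₁ * y + d₁) * (c₂ * x + d₂) := by
    rw [hy]; field_simp; ring
  have hne : (c₁ * a₂ + d₁ * c₂) * x + (c₁ * b₂ + d₁ * d₂) ≠ 0 := by
    rw [hden]; exact mul_ne_zero hne₁ hne₂
  have hval : ((a₁ * a₂ + b₁ * c₂) * x + (a₁ * b₂ + b₁ * d₂)) / ((c₁ * a₂ + d₁ * c₂) * x + (c₁ * b₂ + d₁ * d₂)) =
      (a₁ * y + b₁) / (c₁ * y + d₁) := by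
    rw [div_eq_div_iff hne hne₁, hy]
    field_simp
    ring
  refine ⟨hne, ?_, ?_⟩
  · rw [hval]; exact hfib₁
  · intro hx0
    rw [hval]
    exact hconn₁ (hconn₂ hx0)

/-- `𝒫(a, b, c, d)` for rational entries with an INTEGRAL FORM of S-congruence shape — `a qᴶ, b qᴶ, c qᴶ, d qᴶ` integers
`a₀, b₀, c₀, d₀` with `a₀ d₀ − b₀ c₀ = qᵏ`, `N ∣ c₀`, `d₀ ≡ ±qⁱ (mod N)` — as soon as `b/d` (the image of `0`) is joined to `0`
(`N ≥ 2`).  This is LEMMA T assembled: transport of a path edge by edge. -/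
theorem moebiusGood_of_integral (hN : 2 ≤ N) (hq : q.Prime) (hqN : q.Coprime N) {a b c d : ℚ} {J k : ℕ}
    {a₀ b₀ c₀ d₀ : ℤ} (ha : a * (q : ℚ) ^ J = a₀) (hb : b * (q : ℚ) ^ J = b₀) (hc : c * (q : ℚ) ^ J = c₀)
    (hd : d * (q : ℚ) ^ J = d₀) (hdet : a₀ * d₀ - b₀ * c₀ = (q : ℤ) ^ k) (hc₀ : (N : ℤ) ∣ c₀)
    (hd₀ : ∃ i : ℕ, (d₀ : ZMod N) = (q : ZMod N) ^ i ∨ (d₀ : ZMod N) = -((q : ZMod N) ^ i))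
    (h0 : Relation.ReflTransGen (fun x y : ℚ ↦ QFareyAdj N q (x.num, x.den) (y.num, y.den)) 0 (b / d)) :
    ∀ x : ℚ, InFibre N q x.den →
      c * x + d ≠ 0 ∧ InFibre N q ((a * x + b) / (c * x + d)).den ∧
        (Relation.ReflTransGen (fun x y : ℚ ↦ QFareyAdj N q (x.num, x.den) (y.num, y.den)) 0 x →
          Relation.ReflTransGen (fun x y : ℚ ↦ QFareyAdj N q (x.num, x.den) (y.num, y.den)) 0
            ((a * x + b) / (c * x + d))) := by
  have hqJ : ((q : ℚ) ^ J) ≠ 0 := pow_ne_zero _ (by exact_mod_cast hq.ne_zero)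
  -- the rational map equals the integral one
  have hval : ∀ x : ℚ, (a * x + b) / (c * x + d) = ((a₀ : ℚ) * x + b₀) / ((c₀ : ℚ) * x + d₀) := by
    intro x
    rw [← mul_div_mul_right (a * x + b) (c * x + d) hqJ, ← ha, ← hb, ← hc, ← hd]
    congr 1 <;> ring
  have hdenq : ∀ x : ℚ, (c₀ : ℚ) * x + d₀ = (c * x + d) * (q : ℚ) ^ J := by
    intro x; rw [← hc, ← hd]; ring
  intro x hx
  have hne₀ := moebius_den_ne_zero' hN hqN hc₀ hd₀ x hx
  have hne : c * x + d ≠ 0 := by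
    intro h0; apply hne₀; rw [hdenq, h0, zero_mul]
  refine ⟨hne, ?_, ?_⟩
  · rw [hval]; exact inFibre_den_moebius hN hq hqN hdet hc₀ hd₀ x hx
  · intro hpath
    rw [hval]
    -- transport the path edge by edge; its start `0` goes to `b₀/d₀ = b/d`
    have key : ∀ z : ℚ, Relation.ReflTransGen (fun x y : ℚ ↦ QFareyAdj N q (x.num, x.den) (y.num, y.den)) 0 z →
        Relation.ReflTransGen (fun x y : ℚ ↦ QFareyAdj N q (x.num, x.den) (y.num, y.den)) 0
          (((a₀ : ℚ) * z + b₀) / ((c₀ : ℚ) * z + d₀)) := by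
      intro z hz
      induction hz with
      | refl =>
        have : ((a₀ : ℚ) * 0 + b₀) / ((c₀ : ℚ) * 0 + d₀) = b / d := by
          rw [← hval 0]; simp
        rw [this]; exact h0
      | tail _ hwz ih => exact ih.tail (qFareyAdj_moebius hN hq hqN hdet hc₀ hd₀ _ _ hwz)
    exact key x hpath

end Good

end Summit.BirchSwinnertonDyer.BirchSwinnertonDyer.Theorems.ManinLocalTwoThree
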